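import Literature.IUT.HodgeTheaters.ThetaPMEllNFHodgeTheatersIso

/-!
# [IUTchI] §6, Definition 6.13 (ii) as printed and `†ℋ𝒯^{Θ±ellNF} ↦ †ℋ𝒯^{𝒟-Θ±ellNF}`

Mochizuki, *Inter-universal Teichmüller theory I*, §6, Remark 6.12.2 (i), (ii) pp. 174–175 and
Definition 6.13 (i), (ii) pp. 182–183, kurims manuscript (May 2020)
([IUTchI] Def 6.13 (ii) p.183) [claim: Mochizuki2012, status: disputed]. Sibling of
`ThetaPMEllHodgeTheaters.lean` (abc-iut-L5-t4: `S5Local.ThetaGluing`, `ThetaPMEllNFHT`,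
`DThetaPMEllNFHT`) and of `ThetaPMEllNFHodgeTheatersIso.lean` (abc-iut-L5-t5: `S5Local.IsoKit`,
`DNFHT`, the isomorphism notions), recording the L5 debt "Def 6.13 (ii) (b) strictification /
iso-invariance law" (review of p410040 point 6; L5-lead rulings 2026-08-25 22:59:13Z, 23:35:38Z):

* `S5Local.DThetaGluing`: the `𝒟`-level gluing datum of Rmk 6.12.2 (i) — an identification of index
  sets `J ⥲ T^⋇` under which the capsule-full / full poly-isomorphisms are compatible with the two
  `𝒟-Θ`-bridges (the given one and Proposition 6.7's) — one level below `ThetaGluing`, whose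
  compatibility condition is already a condition on the associated `𝒟`-prime-strips (`ThetaGluing.toD`);
* `S5Local.DThetaPMEllNFHodgeTheater`: Def 6.13 (ii) AS PRINTED, "a triple … (a) a `𝒟-Θ^{±ell}`-Hodge
  theater; (b) a `𝒟-ΘNF`-Hodge theater; (c) the [necessarily unique!] gluing isomorphism", with (b) an
  INDEPENDENT `𝒟-ΘNF`-Hodge theater (kit form `DNFHT`). The frozen `DThetaPMEllNFHT` of
  `ThetaPMEllHodgeTheaters.lean` is its STRICTIFICATION (the `𝒟`-NF-bridge placed directly on
  Proposition 6.7's output, the gluing being the identity); both directions of comparison are given: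
  `DThetaPMEllNFHT.toHodgeTheater` (PROVED: the identity is a gluing — the poly-morphisms of
  Proposition 6.7's output absorb automorphisms on either side) and, under the transport law below,
  `DThetaPMEllNFHodgeTheater.strictify`;
* the functorial passage `ThetaPMEllNFHT.toD` ("the associated `𝒟-Θ^{±ell}NF`-Hodge theater", the
  operation [IUTchII] §4 / [IUTchIII] Def 1.1, Thm 1.5 apply to Θ^{±ell}NF-Hodge theaters), the
  isomorphisms `DThetaPMEllNFHodgeTheater.Iso` with `ThetaPMEllNFHT.Iso.toD`, and the full
  poly-isomorphisms;
* the hypothesis `S5Local.GluingTransportLaw` (TODO-merge:abc-iut-L5-t3): transporting the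
  `𝒟`-NF-bridge of a `𝒟-ΘNF`-Hodge theater along a gluing onto Proposition 6.7's output again "forms a
  `𝒟-ΘNF`-Hodge theater" — in print a consequence of Proposition 6.7 (the output IS a `𝒟-Θ`-bridge) and
  of the shape of the model `𝒟`-NF-bridge ([IUTchI] Example 4.3 (ii), (iii) p. 100: "the poly-morphism
  given by the collection of morphisms `β ∘ φ^{NF}_{•,v} ∘ α` — where `α ∈ Aut(𝒟_v)` …", so NF
  poly-morphisms absorb automorphisms of the source); the kit `S5Local` states `IsDThetaNFHT` as an
  opaque predicate, so the law is a named hypothesis with a consistency inhabitant over the toy kits.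

What is NOT here: the guard of `GluingUnique` (`S5Local.GluingUniqueBad`, abc-iut-L5-t5's file); any
assertion of an [IUTchI] result.
-/

namespace Literature.IUT.HodgeTheaters

open CategoryTheory

universe u

namespace PMBaseKit

variable {l : ℕ} {K : PMBaseKit.{u} l} {M : K.MultKit} {FK : K.FKit M} (N : K.S5Local M FK)

namespace S5Local

/-! ### Remark 6.12.2 (i) at the level of base objects -/

/-- **Rmk 6.12.2 (i), `𝒟`-level**: a `𝒟-Θ`-bridge `(‡𝔇_J → ‡𝔇_>)` (here: that of a `𝒟-ΘNF`-Hodge theater in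
kit form) "is glued to" a `𝒟-Θ^±`-bridge "via the functorial algorithm of Proposition 6.7", its
`𝒟-Θ`-bridge arising "as the `𝒟-Θ`-bridge associated to" the `𝒟-Θ^±`-bridge "[so `J = T^⋇`]" ([IUTchI]
Rmk 6.12.2 (i) p. 174): an identification of index sets `J ⥲ T^⋇` under which the capsule-full
poly-isomorphism `‡𝔇_J ⥲ †𝔇_{T^⋇}` and the full poly-isomorphism `‡𝔇_> ⥲ †𝔇_>` (Def 4.6 (ii): an
isomorphism of `𝒟-Θ`-bridges is such a pair) are compatible with the two `𝒟-Θ`-bridges — the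
composite poly-morphisms `‡𝒟_{v_j} ⥲ †𝒟_{v_{T^⋇}} → †𝒟_{>,v}` and `‡𝒟_{v_j} → ‡𝒟_{>,v} ⥲ †𝒟_{>,v}` coincide ("A
similar [but easier!] construction may be given for `𝒟-Θ`-bridges and `𝒟-Θ^±`-bridges", ibid.). The
`𝒟`-level form of `ThetaGluing`. ([IUTchI] Rmk 6.12.2 (i) p.174) [claim: Mochizuki2012, status: disputed] -/
structure DThetaGluing (B : K.DThetaPMBridge) (X : N.DNFHT) (hl : Odd l) where
  /-- `J ⥲ T^⋇` -/
  indexEquiv : X.thBridge.J ≃ B.grpT.AbsStar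
  /-- compatibility of the (capsule-)full poly-isomorphisms with the two `𝒟-Θ`-bridges -/
  compat : ∀ j v,
    {h | ∃ (φ : (X.thBridge.capsule j).obj v ≅ (B.starCapsule (indexEquiv j)).obj v)
        (g : (B.starCapsule (indexEquiv j)).obj v ⟶ B.codomain.obj v),
        g ∈ (B.thetaBridgeData M hl).poly ⟨indexEquiv j⟩ v ∧ h = φ.hom ≫ g} =
    {h | ∃ (f : (X.thBridge.capsule j).obj v ⟶ X.thBridge.codomain.obj v)
        (ψ : X.thBridge.codomain.obj v ≅ B.codomain.obj v), f ∈ X.thBridge.poly j v ∧ h = f ≫ ψ.hom}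

variable {N}

/-- The gluing datum of Rmk 6.12.2 (i) on the associated `𝒟`-objects: an `ℱ`-level gluing (`ThetaGluing`,
whose compatibility condition concerns the associated `𝒟`-prime-strips) IS a `𝒟`-level gluing of the
associated `𝒟-ΘNF`-Hodge theater to the associated `𝒟-Θ^±`-bridge ([IUTchI] Rmk 6.12.2 (i) p. 174;
Def 6.13 (ii) (c)). ([IUTchI] Rmk 6.12.2 (i) p.174) [claim: Mochizuki2012, status: disputed] -/
def ThetaGluing.toD (NI : N.IsoKit) {B : FK.ThetaPMBridge} {H : N.ThetaNFHT} {hl : Odd l}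
    (G : N.ThetaGluing B H hl) : N.DThetaGluing B.dBridge (NI.assocD H) hl where
  indexEquiv := Equiv.ulift.trans G.indexEquiv
  compat j v := G.compat j.down v

/-! ### Definition 6.13 (ii) as printed -/

/-- **Def 6.13 (ii)** (as printed): a **`𝒟-Θ^{±ell}NF`-Hodge theater** `†ℋ𝒯^{𝒟-Θ±ellNF}` "[is] a triple,
consisting of the following data: (a) a `𝒟-Θ^{±ell}`-Hodge theater `†ℋ𝒯^{𝒟-Θ±ell}`; (b) a `𝒟-ΘNF`-Hodge
theater `†ℋ𝒯^{𝒟-ΘNF}`; (c) the [necessarily unique!] gluing isomorphism between `†ℋ𝒯^{𝒟-Θ±ell}` and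
`†ℋ𝒯^{𝒟-ΘNF}`" ([IUTchI] Def 6.13 (ii) p. 183), (b) in the kit form `DNFHT` (TODO-merge:abc-iut-L5-t3
`DThetaNFHodgeTheater`), (c) the `𝒟`-level gluing of Rmk 6.12.2 (i). The frozen `DThetaPMEllNFHT`
(same §, `ThetaPMEllHodgeTheaters.lean`) is the strictification in which (b)'s `𝒟-Θ`-bridge IS
Proposition 6.7's output and (c) is the identity (`DThetaPMEllNFHT.toHodgeTheater`,
`DThetaPMEllNFHodgeTheater.strictify`). ([IUTchI] Def 6.13 (ii) p.183) [claim: Mochizuki2012, status: disputed] -/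
structure DThetaPMEllNFHodgeTheater (N : K.S5Local M FK) (hl : Odd l) where
  /-- (a) the `𝒟-Θ^{±ell}`-Hodge theater -/
  pmEll : K.DThetaPMEllHT
  /-- (b) the `𝒟-ΘNF`-Hodge theater -/
  dnf : N.DNFHT
  /-- (c) the gluing of (b)'s `𝒟-Θ`-bridge to (a)'s `𝒟-Θ^±`-bridge via Proposition 6.7 -/
  gluing : N.DThetaGluing pmEll.pmBridge dnf hl

/-- **The associated `𝒟-Θ^{±ell}NF`-Hodge theater** of a Θ^{±ell}NF-Hodge theater: componentwise the
associated `𝒟-Θ^{±ell}`-Hodge theater (Def 6.11 (iii)), the associated `𝒟-ΘNF`-Hodge theater (Def 5.5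
(iii), kit `IsoKit.assocD`) and the same gluing ([IUTchI] Def 6.13 (i), (ii) pp. 182–183; the passage
`†ℋ𝒯^{Θ±ellNF} ↦ †ℋ𝒯^{𝒟-Θ±ellNF}` used throughout [IUTchII] §4, [IUTchIII] §1).
([IUTchI] Def 6.13 (ii) p.183) [claim: Mochizuki2012, status: disputed] -/
noncomputable def ThetaPMEllNFHT.toD (NI : N.IsoKit) {hl : Odd l} (X : N.ThetaPMEllNFHT hl) :
    N.DThetaPMEllNFHodgeTheater hl :=
  ⟨X.pmEll.dHT, NI.assocD X.thNF, X.gluing.toD NI⟩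

/-- **Rmk 6.12.2 (ii)**, isomorphisms of `𝒟-Θ^{±ell}NF`-Hodge theaters in the printed (triple) form
(analogue of Def 4.6 (iii) / Def 6.4 (iii); "one may verify analogues of these results for such
Θ^{±ell}NF-Hodge theaters", [IUTchI] Rmk 6.12.2 (ii) pp. 174–175): an isomorphism of the
`𝒟-Θ^{±ell}`-Hodge theaters (a) and an isomorphism of the `𝒟-ΘNF`-Hodge theaters (b) (kit `IsoKit.dIso`)
compatible with the gluings (c): the square of index sets `J → T^⋇`, `J' → T'^⋇` commutes.
([IUTchI] Rmk 6.12.2 (ii) p.175) [claim: Mochizuki2012, status: disputed] -/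
structure DThetaPMEllNFHodgeTheater.Iso (NI : N.IsoKit) {hl : Odd l}
    (X₁ X₂ : N.DThetaPMEllNFHodgeTheater hl) where
  /-- the isomorphism of `𝒟-Θ^{±ell}`-Hodge theaters -/
  pm : DThetaPMEllHT.Iso X₁.pmEll X₂.pmEll
  /-- the isomorphism of `𝒟-ΘNF`-Hodge theaters -/
  nf : NI.dIso X₁.dnf X₂.dnf
  /-- compatibility with the gluings: the square `J → T^⋇`, `J' → T'^⋇` commutes -/
  compat : ∀ (j : X₁.dnf.thBridge.J) (t : X₁.pmEll.T),
    X₁.pmEll.grpT.toAbs t = (X₁.gluing.indexEquiv j).1 →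
      X₂.pmEll.grpT.toAbs (pm.pmIso.indexEquiv t) = (X₂.gluing.indexEquiv (NI.dIsoIndex nf j)).1

/-- "The natural functorially induced map" from isomorphisms of Θ^{±ell}NF-Hodge theaters to
isomorphisms of the associated `𝒟-Θ^{±ell}NF`-Hodge theaters (componentwise: Cor 6.12 (i) for (a), Cor
5.6 (ii) — kit field `IsoKit.thIsoToD` — for (b); [IUTchI] Rmk 6.12.2 (ii) p. 175 "by applying
Propositions 4.8, 6.6, and Corollaries 5.6, 6.12"). ([IUTchI] Rmk 6.12.2 (ii) p.175) [claim: Mochizuki2012, status: disputed] -/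
noncomputable def ThetaPMEllNFHT.Iso.toD {NI : N.IsoKit} {hl : Odd l} {X₁ X₂ : N.ThetaPMEllNFHT hl}
    (f : ThetaPMEllNFHT.Iso NI X₁ X₂) : DThetaPMEllNFHodgeTheater.Iso NI (X₁.toD NI) (X₂.toD NI) where
  pm := f.pm.toD
  nf := NI.thIsoToD f.nf
  compat := by
    rintro ⟨j⟩ t h
    have hidx : (NI.dIsoIndex (NI.thIsoToD f.nf) ⟨j⟩).down = NI.thIsoIndex f.nf j := by
      rw [NI.thIsoToD_index f.nf j]
    change X₂.pmEll.grpT.toAbs (f.pm.toD.pmIso.indexEquiv t) =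
      (X₂.gluing.indexEquiv (NI.dIsoIndex (NI.thIsoToD f.nf) ⟨j⟩).down).1
    rw [hidx]
    exact f.compat j t h

/-- The **full poly-isomorphism** between two `𝒟-Θ^{±ell}NF`-Hodge theaters (printed form): all
isomorphisms (§0 p. 33; the noun of [IUTchII] Cor 4.10, [IUTchIII] Def 1.1, Thm 1.5 for the
`𝒟`-versions). ([IUTchI] Rmk 6.12.2 (ii) p.175) [claim: Mochizuki2012, status: disputed] -/
def DThetaPMEllNFHodgeTheater.fullPolyIso (NI : N.IsoKit) {hl : Odd l}
    (X₁ X₂ : N.DThetaPMEllNFHodgeTheater hl) : Set (DThetaPMEllNFHodgeTheater.Iso NI X₁ X₂) := Set.univ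

/-- A poly-isomorphism of `𝒟-Θ^{±ell}NF`-Hodge theaters (printed form) **is full** if it is the full
poly-isomorphism. ([IUTchI] Rmk 6.12.2 (ii) p.175) [claim: Mochizuki2012, status: disputed] -/
def DThetaPMEllNFHodgeTheater.IsFullPolyIso {NI : N.IsoKit} {hl : Odd l}
    {X₁ X₂ : N.DThetaPMEllNFHodgeTheater hl} (P : Set (DThetaPMEllNFHodgeTheater.Iso NI X₁ X₂)) : Prop :=
  P = Set.univ

/-! ### The strictification and the transport law -/

/-- Transporting the `𝒟`-NF-bridge poly-morphisms `‡φ^{NF}_j : ‡𝒟_{v_j} → ‡𝒟^⊚` of a `𝒟-ΘNF`-Hodge theater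
along a gluing onto Proposition 6.7's output capsule `†𝔇_{T^⋇}`: the composites with the (capsule-)full
poly-isomorphism `†𝒟_{v_{T^⋇}} ⥲ ‡𝒟_{v_j}` ([IUTchI] Rmk 6.12.2 (i) p. 174; in print such composites are
again of the shape `β ∘ φ^{NF}_{•,v} ∘ α`, `α ∈ Aut(𝒟_v)`, Example 4.3 (ii), (iii) p. 100).
([IUTchI] Rmk 6.12.2 (i) p.174) [claim: Mochizuki2012, status: disputed] -/
def DThetaGluing.transportNF {B : K.DThetaPMBridge} {X : N.DNFHT} {hl : Odd l}
    (G : N.DThetaGluing B X hl) (q : ULift.{u} B.grpT.AbsStar) (v : K.V) :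
    Set (((B.thetaBridgeData M hl).capsule q).obj v ⟶ (N.nfAtV v).obj X.glob) :=
  {h | ∃ (φ : (B.starCapsule q.down).obj v ≅ (X.thBridge.capsule (G.indexEquiv.symm q.down)).obj v)
      (f : (X.thBridge.capsule (G.indexEquiv.symm q.down)).obj v ⟶ (N.nfAtV v).obj X.glob),
      f ∈ X.nfPoly (G.indexEquiv.symm q.down) v ∧ h = φ.hom ≫ f}

/-- TODO-merge:abc-iut-L5-t3 Def 4.6 (iii) / Prop 6.7 / Example 4.3. **Transport law for `𝒟-ΘNF`-Hodge
theaters along gluings** (the iso-invariance of "forms a `𝒟-ΘNF`-Hodge theater" that the kit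
`S5Local` does not state): gluing a `𝒟-ΘNF`-Hodge theater to a `𝒟-Θ^±`-bridge "via the functorial
algorithm of Proposition 6.7" ([IUTchI] Rmk 6.12.2 (i) p. 174) makes Proposition 6.7's output
`𝒟-Θ`-bridge "[well-defined, up to a unique isomorphism!] `𝒟-Θ`-bridge … as in Definition 4.6, (ii)"
(Prop 6.7 p. 167), together with the same global object and the transported `𝒟`-NF-bridge, again
satisfy "there exist isomorphisms `𝒟^⊚ ⥲ †𝒟^⊚`; `𝔇_⋆ ⥲ †𝔇_J`; `𝔇_> ⥲ †𝔇_>`, conjugation by which maps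
`φ^{NF}_⋆ ↦ †φ^{NF}_⋆`, `φ^Θ_⋆ ↦ †φ^Θ_⋆`" (Def 4.6 (iii) p. 112) — in print because the model poly-morphisms
`φ^{NF}_v` "given by the collection of morphisms … `β ∘ φ^{NF}_{•,v} ∘ α` — where `α ∈ Aut(𝒟_v)`"
(Example 4.3 (ii), (iii) p. 100) and `φ^Θ_{v_j}` "obtained by composing with arbitrary isomorphisms"
(Example 4.4 (ii) p. 107) absorb isomorphisms. A hypothesis on the kit, NOT asserted.
([IUTchI] Def 4.6 (iii) p.112) [claim: Mochizuki2012, status: disputed] -/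
structure GluingTransportLaw (N : K.S5Local M FK) (hl : Odd l) : Prop where
  /-- the transported data form a `𝒟-ΘNF`-Hodge theater -/
  isDThetaNFHT_transport : ∀ (B : K.DThetaPMBridge) (X : N.DNFHT) (G : N.DThetaGluing B X hl),
    N.IsDThetaNFHT (B.thetaBridgeData M hl) X.glob G.transportNF

/-- Under the transport law, the **strictification** of a printed-form `𝒟-Θ^{±ell}NF`-Hodge theater: the
`𝒟`-NF-bridge of (b) transported along (c) onto Proposition 6.7's output (the frozen rendering
`DThetaPMEllNFHT` of [IUTchI] Def 6.13 (ii) p. 183). ([IUTchI] Def 6.13 (ii) p.183) [claim: Mochizuki2012, status: disputed] -/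
def DThetaPMEllNFHodgeTheater.strictify {hl : Odd l} (law : N.GluingTransportLaw hl)
    (X : N.DThetaPMEllNFHodgeTheater hl) : N.DThetaPMEllNFHT hl :=
  ⟨X.pmEll, X.dnf.glob, X.gluing.transportNF, law.isDThetaNFHT_transport _ _ X.gluing⟩

/-- Under the transport law, the associated STRICT `𝒟-Θ^{±ell}NF`-Hodge theater of a Θ^{±ell}NF-Hodge
theater (so that abc-iut-L5-t5's `DThetaPMEllNFHT.Iso` / `fullPolyIso` apply to associated
`𝒟`-objects). ([IUTchI] Def 6.13 (ii) p.183) [claim: Mochizuki2012, status: disputed] -/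
noncomputable def ThetaPMEllNFHT.toDStrict (NI : N.IsoKit) {hl : Odd l} (law : N.GluingTransportLaw hl)
    (X : N.ThetaPMEllNFHT hl) : N.DThetaPMEllNFHT hl :=
  (X.toD NI).strictify law

end S5Local

/-! ### The identity is a gluing: Proposition 6.7's poly-morphisms absorb automorphisms -/

namespace DThetaPMBridge

variable (B : K.DThetaPMBridge)

/-- For every identification `β'` of the model `𝒟_v` with `†𝒟_{≻,v}` there is an identification `α` of
`𝒟_v` with `†𝒟_{v_t}` under which the constituents at `v` of the `+`-full poly-isomorphism `†φ^{Θ±}_t`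
become POSITIVE automorphisms of `𝒟_v` (the compatibility used by Proposition 6.7's transport at
`v ∈ 𝕍^bad`, [IUTchI] Prop 6.7 p. 167): from the defining model isomorphisms of the bridge (Def 6.4 (i)
"conjugation by which maps `φ^{Θ±}_± ↦ †φ^{Θ±}_±`") twisted by `β'`.
([IUTchI] Prop 6.7 p.167) [claim: Mochizuki2012, status: disputed] -/
theorem exists_label_compat_of_cod (t : B.T) (v : K.V) (β' : K.model v ≅ B.codomain.obj v) :
    ∃ α : K.model v ≅ (B.capsule t).obj v,
      ∀ f ∈ B.poly t, K.labMap v (α ≪≫ f v ≪≫ β'.symm) = Equiv.refl _ := by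
  obtain ⟨ι, -, αz, β, hpoly⟩ := B.exists_model
  obtain ⟨z, rfl⟩ := ι.surjective t
  refine ⟨(β' ≪≫ (β v).symm) ≪≫ αz z v, fun f hf => ?_⟩
  rw [hpoly z] at hf
  obtain ⟨g, hg, rfl⟩ := hf
  have hg' : g ∈ (DStrip.model K).autPlus := by
    have h1 : g ∈ (DStrip.model K).autSigned (fun _ => 1) := hg
    rwa [DStrip.autSigned_one] at h1
  have hgv : K.labMap v (g v) = Equiv.refl _ :=
    (K.mem_autPlus_iff _).mp (((DStrip.model K).mem_autPlus_iff g).mp hg' v)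
  simp only [DStrip.Iso.trans, DStrip.Iso.symm, Iso.trans_assoc, Iso.self_symm_id_assoc, K.labMap_trans,
    labMap_symm, hgv]
  ext x
  simp

/-- Symmetrically: for every identification `α'` of `𝒟_v` with `†𝒟_{v_t}` there is an identification `β`
of `𝒟_v` with `†𝒟_{≻,v}` making the constituents of `†φ^{Θ±}_t` at `v` positive ([IUTchI] Prop 6.7 p. 167).
([IUTchI] Prop 6.7 p.167) [claim: Mochizuki2012, status: disputed] -/
theorem exists_label_compat_of_caps (t : B.T) (v : K.V) (α' : K.model v ≅ (B.capsule t).obj v) :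
    ∃ β : K.model v ≅ B.codomain.obj v,
      ∀ f ∈ B.poly t, K.labMap v (α' ≪≫ f v ≪≫ β.symm) = Equiv.refl _ := by
  obtain ⟨ι, -, αz, β, hpoly⟩ := B.exists_model
  obtain ⟨z, rfl⟩ := ι.surjective t
  refine ⟨(α' ≪≫ (αz z v).symm) ≪≫ β v, fun f hf => ?_⟩
  rw [hpoly z] at hf
  obtain ⟨g, hg, rfl⟩ := hf
  have hg' : g ∈ (DStrip.model K).autPlus := by
    have h1 : g ∈ (DStrip.model K).autSigned (fun _ => 1) := hg
    rwa [DStrip.autSigned_one] at h1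
  have hgv : K.labMap v (g v) = Equiv.refl _ :=
    (K.mem_autPlus_iff _).mp (((DStrip.model K).mem_autPlus_iff g).mp hg' v)
  simp only [DStrip.Iso.trans, DStrip.Iso.symm, Iso.trans_assoc, Iso.trans_symm, Iso.symm_symm_eq,
    K.labMap_trans, labMap_symm, hgv]
  ext x
  simp

/-- **Proposition 6.7's poly-morphisms absorb automorphisms on either side, up to the other side**:
for the output `†φ^Θ_⋇ : †𝔇_{T^⋇} → †𝔇_>` of Proposition 6.7, the composite of the full poly-automorphism of
`†𝒟_{v_{T^⋇}}` with `†φ^Θ_{v_j}` equals the composite of `†φ^Θ_{v_j}` with the full poly-automorphism of `†𝒟_{>,v}`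
([IUTchI] Prop 6.7 p. 167: at `v ∈ 𝕍^good` the constituents are full poly-isomorphisms, at `v ∈ 𝕍^bad`
the model poly-morphisms of Example 4.4 transported along all compatible identifications; Example 4.4
(ii) p. 107 "composing with arbitrary isomorphisms"). PROVED; it is what makes the identity a gluing.
([IUTchI] Prop 6.7 p.167) [claim: Mochizuki2012, status: disputed] -/
theorem thetaBridgeData_aut_comp_eq_comp_aut (hl : Odd l) (q : ULift.{u} B.grpT.AbsStar) (v : K.V) :
    {h | ∃ (φ : (B.starCapsule q.down).obj v ≅ (B.starCapsule q.down).obj v)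
        (g : (B.starCapsule q.down).obj v ⟶ B.codomain.obj v),
        g ∈ (B.thetaBridgeData M hl).poly q v ∧ h = φ.hom ≫ g} =
    {h | ∃ (f : (B.starCapsule q.down).obj v ⟶ B.codomain.obj v)
        (ψ : B.codomain.obj v ≅ B.codomain.obj v), f ∈ (B.thetaBridgeData M hl).poly q v ∧ h = f ≫ ψ.hom} := by
  ext h
  simp only [thetaBridgeData, Set.mem_setOf_eq]
  by_cases hv : v ∈ K.bad
  · simp only [dif_pos hv]
    constructor
    · rintro ⟨φ, g, ⟨α, β, hαβ, g₀, hg₀, rfl⟩, rfl⟩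
      obtain ⟨β₁, hβ₁⟩ := B.exists_label_compat_of_caps (Quotient.out q.down.1) v (α ≪≫ φ.symm)
      refine ⟨(α ≪≫ φ.symm).inv ≫ g₀ ≫ β₁.hom, β₁.symm ≪≫ β, ⟨α ≪≫ φ.symm, β₁, hβ₁, g₀, hg₀, rfl⟩, ?_⟩
      simp
    · rintro ⟨f, ψ, ⟨α, β, hαβ, g₀, hg₀, rfl⟩, rfl⟩
      obtain ⟨α₁, hα₁⟩ := B.exists_label_compat_of_cod (Quotient.out q.down.1) v (β ≪≫ ψ)
      refine ⟨α.symm ≪≫ α₁, α₁.inv ≫ g₀ ≫ (β ≪≫ ψ).hom, ⟨α₁, β ≪≫ ψ, hα₁, g₀, hg₀, rfl⟩, ?_⟩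
      simp
  · simp only [dif_neg hv]
    constructor
    · rintro ⟨φ, g, ⟨f, rfl⟩, rfl⟩
      exact ⟨(φ ≪≫ f).hom, Iso.refl _, ⟨φ ≪≫ f, rfl⟩, by simp⟩
    · rintro ⟨f, ψ, ⟨g, rfl⟩, rfl⟩
      exact ⟨Iso.refl _, (g ≪≫ ψ).hom, ⟨g ≪≫ ψ, rfl⟩, by simp⟩

end DThetaPMBridge

namespace S5Local

/-- The frozen strict rendering IS a printed-form `𝒟-Θ^{±ell}NF`-Hodge theater: (b) := its `𝒟-ΘNF`-Hodge
theater on Proposition 6.7's output (`DThetaPMEllNFHT.dnf`), (c) := the identity gluing — a gluing by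
`thetaBridgeData_aut_comp_eq_comp_aut` ([IUTchI] Def 6.13 (ii) p. 183; Rmk 6.12.2 (i)). PROVED.
([IUTchI] Def 6.13 (ii) p.183) [claim: Mochizuki2012, status: disputed] -/
noncomputable def DThetaPMEllNFHT.toHodgeTheater {hl : Odd l} (X : N.DThetaPMEllNFHT hl) :
    N.DThetaPMEllNFHodgeTheater hl where
  pmEll := X.pmEll
  dnf := X.dnf
  gluing :=
    { indexEquiv := Equiv.ulift
      compat := fun j v => X.pmEll.pmBridge.thetaBridgeData_aut_comp_eq_comp_aut (M := M) hl j v }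

end S5Local

/-! ### Consistency: the transport law over the toy kits -/

/-- Over the toy kits (`S5Local.toy`: "forms a `𝒟-ΘNF`-Hodge theater" is `True`) the transport law holds —
a consistency inhabitant of the hypothesis `GluingTransportLaw` ([IUTchI] Def 4.6 (iii) p. 112).
([IUTchI] Def 4.6 (iii) p.112) [claim: Mochizuki2012, status: disputed] -/
theorem S5Local.GluingTransportLaw.toy (l : ℕ) [Fact l.Prime] (hl : l ≠ 2) (hlo : Odd l) :
    (S5Local.toy l hl).GluingTransportLaw hlo :=
  ⟨fun _ _ _ => trivial⟩

/-- Over the toy kits the printed-form type is inhabited: the strict toy object assembled from the model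
`𝒟-Θ^{±ell}`-Hodge theater of Examples 6.2 (i) / 6.3 (i) (`Ex62.ht`) with empty NF-data, un-strictified by
`toHodgeTheater` — consistency of Def 6.13 (ii) relative to the kits ([IUTchI] Def 6.13 (ii) p. 183).
([IUTchI] Def 6.13 (ii) p.183) [claim: Mochizuki2012, status: disputed] -/
noncomputable def S5Local.DThetaPMEllNFHodgeTheater.toy (l : ℕ) [Fact l.Prime] (hl : l ≠ 2) (hlo : Odd l) :
    (S5Local.toy l hl).DThetaPMEllNFHodgeTheater hlo :=
  haveI : NeZero l := ⟨(Fact.out : l.Prime).ne_zero⟩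
  (⟨Ex62.ht (toyKit l hl), SingleObj.star (Model.AGL l), fun _ _ => ∅, trivial⟩ :
    (S5Local.toy l hl).DThetaPMEllNFHT hlo).toHodgeTheater

end PMBaseKit

end Literature.IUT.HodgeTheaters
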